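import Literature.NumberTheory.EllipticCurves.LocalTateSelfDualityTorsionLevelChange
import Literature.NumberTheory.EllipticCurves.CompactSelmerKummerDescent
import Literature.NumberTheory.PAdicHodge.DualExpElliptic
import HarnessLib

/-!
# The `ℤ_p`-valued local Tate pairing on `H¹(F, T_pW)` as the limit of the level-`p^k` self-pairings

Topic `NumberTheory/EllipticCurves`; namespace `Literature.NumberTheory.EllipticCurves`. Sequel of
`LocalTateSelfDualityTorsion{,LevelChange}.lean` (brick K2 floors (a)–(b) of the hT₂ programme of crux K★
stmt-BirchSwinnertonDyer-22226, memo `Summits/BirchSwinnertonDyer/BirchSwinnertonDyer/Cruxes/StarredOptimalManinUnitFiveSeven/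
Lines/kato-lever-hT2-programme.md` §4): floor (c). Definitions with bodies and theorems; no named fact, no instance,
no `sorry`.

Setting: `W/K₀` elliptic (`char K₀ = 0`), `F ⊇ K₀` a non-archimedean local field of characteristic `0`, `p` a prime,
and a LEVEL-COMPATIBLE tower of Weil pairings `e_k` on `E[p^k]` (`e_k(pS, pT) = e_{k+1}(S, T)^p` — Silverman III.8.1 (e);
the tree CONSTRUCTS one: `WeierstrassCurve.exists_weilPairing_tower`). The representation is the integral Tate module
restricted to `Γ_F`, `PAdicHodge.restrictedTateRep W F p` — THE representation of the cite facts (S5a)/(S5b)/hT₂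
(`contOneCocycles (restrictedTateRep W F p).toTopRep` are their `η`'s).

* `tateProjHom` / `tateProjMor W F p k` — the projection `T_pW|_{Γ_F} ⟶ E[p^k]|_{Γ_F}` (`TateModule.proj`) as a morphism
  of topological `Γ_F`-representations, for `W` over ANY `K₀` and at the `ℕ`-levels `p^k` of `torsionRestricted` (the
  `K₀ = ℚ`, `Γ_ℚ`-subgroup, level-`(p : ℤ)^k` twin is `Kato2004.tateModPk` of `Kato2004/IwasawaH1ReductionPk.lean`; same
  underlying points, `coe_tateProjHom` / `coe_tateModPk_apply`); `cohomologyMap_torsionMulMor_tateProjMor`: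
  `p ∘ pr_{k+1} = pr_k` on `H^q` (`TateModule.smul_proj_succ`);
* `tateLevelValue k x y := ⟨pr_k x, pr_k y⟩_{p^k, inv_{p^k}} ∈ ℤ/p^k` and ★ `castHom_tateLevelValue_succ`:
  **`⟨pr_{k+1} x, pr_{k+1} y⟩_{p^{k+1}} mod p^k = ⟨pr_k x, pr_k y⟩_{p^k}`** (floor (b): `levelTatePairing_invLevel_levelChange`);
* ★★ **`tatePairing : H¹(F, T_pW) →+ H¹(F, T_pW) →+ ℤ_p`**, THE `ℤ_p`-valued local Tate pairing
  `⟨x, y⟩ = (⟨pr_k x, pr_k y⟩_{p^k, inv_{p^k}})_k ∈ lim ℤ/p^k = ℤ_p` (existence by the tree's `p`-adic interpolation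
  `exists_padicInt_toZModPow_eq_intCast`, uniqueness by `PadicInt.ext_of_toZModPow`), characterised by
  `toZModPow_tatePairing : (⟨x, y⟩ mod p^k) = ⟨pr_k x, pr_k y⟩_{p^k}` and determined by it (`eq_tatePairing_of_toZModPow`).

This is the pairing `H¹(F, T) × H¹(F, T) → ℤ_p`, `⟨x, y⟩ = inv_F(x ∪_{Weil} y)` of Kato II §1.4 / NSW (7.2.6) / Perrin-Riou
§3.6.1 as a limit of finite-level pairings, for the Tate module of an elliptic curve; floor (d) (unimodularity modulo
torsion, [TD] of the memo) and the reciprocity law [REC] are NOT here. BSD is not proved by any of this.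

## References
* J. Neukirch, A. Schmidt, K. Wingberg, *Cohomology of Number Fields*, 2008, (7.2.6) and II §7 (2.7.5)
  (cohomology of `lim` as `lim` of cohomology). [NeukirchSchmidtWingberg2008]
* K. Kato, LNM 1553 (1993), Ch. II §1.4 (the pairing `H¹(K, T) × H¹(K, T*(1)) → ℤ_p`). [Kato1993LNM1553]
* J. H. Silverman, *The Arithmetic of Elliptic Curves*, 2nd ed. 2009, III §7 (Tate module), Prop. III.8.1 (e). [SilvermanAEC2009]
* J.-P. Serre, *A Course in Arithmetic*, 1973, Ch. II §1 (`ℤ_p = lim ℤ/p^n`). [Serre1973]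
-/

noncomputable section

open CategoryTheory Function Field
open Literature.NumberTheory.GaloisRepresentations
open Literature.NumberTheory.GaloisRepresentations.DiscreteGaloisModule (mu MuCarrier)
open Literature.NumberTheory.PAdicHodge (restrictedTateRep restrictedTateRep_apply_apply)
open Literature.AnabelianGeometry.AbsoluteAnabelian (Prop121vii.invLevel)


namespace Literature.NumberTheory.EllipticCurves

open _root_.WeierstrassCurve

attribute [local instance] absoluteGaloisGroup_compactSpace
attribute [local instance] finite_geomTorsion_of_neZero

-- `PAdicHodge.restrictedTateRep` is universe-monomorphic (`K₀ F : Type`), hence so is this file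
variable {K₀ : Type} [Field K₀] (W : WeierstrassCurve K₀) [W.IsElliptic] (F : Type) [Field F] [Algebra K₀ F]
  (p : ℕ) [hp : Fact p.Prime]

/-- `p^k ≠ 0` instance bookkeeping for the levels. [folklore] -/
private theorem neZero_pow (k : ℕ) : NeZero (p ^ k) := ⟨pow_ne_zero k hp.out.ne_zero⟩

attribute [local instance] neZero_pow

/-! ### The projections `T_pW|_{Γ_F} ⟶ E[p^k]|_{Γ_F}` -/

/-- **The projection `pr_k : T_pW → E[p^k]`** (`(a_m)_m ↦ a_k`, the tree's `TateModule.proj`, valued in the `p^k`-torsion at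
the `ℕ`-level `p^k` of `torsionRestricted`; for `W/ℚ` at the level `(p : ℤ)^k` this is `Kato2004.tateModPk`, same underlying
points). [cite: SilvermanAEC2009, III §7] -/
def tateProjHom (k : ℕ) : W.tateModule p →+ geomTorsion W ((p ^ k : ℕ) : ℤ) where
  toFun a := ⟨TateModule.proj p k a, TateModule.proj_mem_torsionBy k a⟩
  map_zero' := Subtype.ext (map_zero _)
  map_add' a b := Subtype.ext (map_add _ a b)

omit [W.IsElliptic] hp in
/-- Unfolding `tateProjHom` on underlying points. [cite: SilvermanAEC2009, III §7] -/
@[simp] theorem coe_tateProjHom (k : ℕ) (a : W.tateModule p) :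
    ((tateProjHom W p k a : geomTorsion W ((p ^ k : ℕ) : ℤ)) : geomPoints W) = TateModule.proj p k a := rfl

omit [W.IsElliptic] in
/-- **`pr_k : T_pW ⟶ E[p^k]` over `K₀` as a morphism of topological `Γ_{K₀}`-representations** (continuous:
`TateModule.continuous_proj`; equivariant: the action on `T_pW` is componentwise), on the integral Tate representation
`(W.tateGaloisRep p _).toIntRep` whose restriction to `Γ_F` IS `PAdicHodge.restrictedTateRep W F p`. [cite: SilvermanAEC2009, III §7] -/
def tateProjMor₀ (k : ℕ) :
    ((W.tateGaloisRep p (W.continuous_galoisRepTate_holds p)).toIntRep).toTopRep ⟶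
      (W.torsionGaloisModule ((p ^ k : ℕ) : ℤ)).toTopRep :=
  TopRep.ofHom
    { toFun := tateProjHom W p k
      map_add' := map_add _
      map_smul' := fun c a => map_zsmul _ c a
      cont := (TateModule.continuous_proj k).subtype_mk _
      isIntertwining' := fun σ => ContinuousLinearMap.ext fun a => Subtype.ext (by
        change TateModule.proj p k (galoisRepTate W p σ a) =
          ((W.torsionGaloisModule ((p ^ k : ℕ) : ℤ) σ (tateProjHom W p k a) : geomTorsion W ((p ^ k : ℕ) : ℤ)) :
            geomPoints W)
        rw [galoisRepTate_apply_apply, TateModule.proj_smul_of_distribMulAction, torsionGaloisModule_apply_apply,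
          AddSubgroup.torsionBy.coe_smul, coe_tateProjHom]) }

omit [W.IsElliptic] in
/-- **`pr_k : T_pW|_{Γ_F} ⟶ E[p^k]|_{Γ_F}`**: the restriction of `tateProjMor₀` along `absGaloisRestrict K₀ F`
(`TopRep.resFunctor`), a morphism from (the topological representation of) `PAdicHodge.restrictedTateRep W F p` to that of
`torsionRestricted W F (p^k)` (both are the restrictions DEFINITIONALLY). [cite: SilvermanAEC2009, III §7] -/
def tateProjMor (k : ℕ) : (restrictedTateRep W F p).toTopRep ⟶ (torsionRestricted W F (p ^ k)).toTopRep :=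
  (TopRep.resFunctor (absGaloisRestrict K₀ F : absoluteGaloisGroup F →* absoluteGaloisGroup K₀)).map (tateProjMor₀ W p k)

omit [W.IsElliptic] in
/-- Unfolding `tateProjMor`. [cite: SilvermanAEC2009, III §7] -/
@[simp] theorem tateProjMor_hom_apply (k : ℕ) (a : W.tateModule p) :
    (tateProjMor W F p k).hom a = tateProjHom W p k a := rfl

omit [W.IsElliptic] in
/-- **Compatibility of the projections with multiplication by `p`**: `p · pr_{k+1} = pr_k` on `H^q`
(`TateModule.smul_proj_succ`). [cite: SilvermanAEC2009, III §7] -/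
theorem cohomologyMap_torsionMulMor_tateProjMor (k q : ℕ) (x : continuousCohomology q (restrictedTateRep W F p).toTopRep) :
    cohomologyMap (torsionMulMor W F (p ^ (k + 1)) (p ^ k) p (pow_succ p k).symm) q
        (cohomologyMap (tateProjMor W F p (k + 1)) q x) =
      cohomologyMap (tateProjMor W F p k) q x :=
  cohomologyMap_comp_apply_of_eq _ _ _ (fun a => Subtype.ext (by
    change ((p : ℕ) : ℤ) • TateModule.proj p (k + 1) a = TateModule.proj p k a
    rw [natCast_zsmul, TateModule.smul_proj_succ])) q x

/-! ### The level values `⟨pr_k x, pr_k y⟩_{p^k}` and their coherence -/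

variable (e : (k : ℕ) → geomTorsion W ((p ^ k : ℕ) : ℤ) → geomTorsion W ((p ^ k : ℕ) : ℤ) → AlgebraicClosure K₀)
  (hμ : ∀ k S T, e k S T ^ (p ^ k) = 1)
  (hadd₁ : ∀ k S₁ S₂ T, e k (S₁ + S₂) T = e k S₁ T * e k S₂ T)
  (hadd₂ : ∀ k S T₁ T₂, e k S (T₁ + T₂) = e k S T₁ * e k S T₂)
  (hgal : ∀ k (σ : absoluteGaloisGroup K₀) (S T : geomTorsion W ((p ^ k : ℕ) : ℤ)),
    σ • e k S T = e k (σ • S) (σ • T))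
  (hcompat : ∀ k (S T : geomTorsion W ((p ^ (k + 1) : ℕ) : ℤ)),
    e k (torsionMulHom W (p ^ (k + 1)) (p ^ k) p (pow_succ p k).symm S)
      (torsionMulHom W (p ^ (k + 1)) (p ^ k) p (pow_succ p k).symm T) = e (k + 1) S T ^ p)

variable [CharZero F] [ValuativeRel F] [TopologicalSpace F] [IsNonarchimedeanLocalField F]

/-- **The level-`p^k` value `⟨pr_k x, pr_k y⟩_{p^k, inv_{p^k}} ∈ ℤ/p^k`** of two classes `x, y ∈ H¹(F, T_pW)`: the
self-pairing `levelTatePairing` of `E[p^k]|_{Γ_F}` for THE invariant map `Prop121vii.invLevel F (p^k)` at the projections.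
[cite: NeukirchSchmidtWingberg2008, (7.2.6)] -/
def tateLevelValue (k : ℕ) (x y : continuousCohomology 1 (restrictedTateRep W F p).toTopRep) : ZMod (p ^ k) :=
  levelTatePairing W F (p ^ k) (e k) (hμ k) (hadd₁ k) (hadd₂ k) (hgal k) (Prop121vii.invLevel F (p ^ k))
    ((cohomologyMap (tateProjMor W F p k) 1).hom x) ((cohomologyMap (tateProjMor W F p k) 1).hom y)

/-- `tateLevelValue` is additive in the first variable. [cite: NeukirchSchmidtWingberg2008, (7.2.6)] -/
theorem tateLevelValue_add_left (k : ℕ) (x x' y : continuousCohomology 1 (restrictedTateRep W F p).toTopRep) :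
    tateLevelValue W F p e hμ hadd₁ hadd₂ hgal k (x + x') y =
      tateLevelValue W F p e hμ hadd₁ hadd₂ hgal k x y + tateLevelValue W F p e hμ hadd₁ hadd₂ hgal k x' y := by
  simp only [tateLevelValue, map_add, AddMonoidHom.add_apply]

/-- `tateLevelValue` is additive in the second variable. [cite: NeukirchSchmidtWingberg2008, (7.2.6)] -/
theorem tateLevelValue_add_right (k : ℕ) (x y y' : continuousCohomology 1 (restrictedTateRep W F p).toTopRep) :
    tateLevelValue W F p e hμ hadd₁ hadd₂ hgal k x (y + y') =
      tateLevelValue W F p e hμ hadd₁ hadd₂ hgal k x y + tateLevelValue W F p e hμ hadd₁ hadd₂ hgal k x y' := by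
  simp only [tateLevelValue, map_add]

variable [CharZero K₀]

include hcompat in
/-- ★ **Coherence of the level values**: `⟨pr_{k+1} x, pr_{k+1} y⟩_{p^{k+1}} mod p^k = ⟨pr_k x, pr_k y⟩_{p^k}`
(floor (b) `levelTatePairing_invLevel_levelChange` with `N = p^{k+1}`, `n = p^k`, `d = p`, and `p · pr_{k+1} = pr_k`).
[cite: NeukirchSchmidtWingberg2008, (7.2.6)] [cite: SilvermanAEC2009, Prop. III.8.1 (e)] -/
theorem castHom_tateLevelValue_succ (k : ℕ) (x y : continuousCohomology 1 (restrictedTateRep W F p).toTopRep) :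
    ZMod.castHom (pow_dvd_pow p k.le_succ) (ZMod (p ^ k)) (tateLevelValue W F p e hμ hadd₁ hadd₂ hgal (k + 1) x y) =
      tateLevelValue W F p e hμ hadd₁ hadd₂ hgal k x y := by
  have h := levelTatePairing_invLevel_levelChange W F (p ^ (k + 1)) (p ^ k) p (pow_succ p k).symm
    (e (k + 1)) (hμ (k + 1)) (hadd₁ (k + 1)) (hadd₂ (k + 1)) (hgal (k + 1))
    (e k) (hμ k) (hadd₁ k) (hadd₂ k) (hgal k) (hcompat k)
    ((cohomologyMap (tateProjMor W F p (k + 1)) 1).hom x) ((cohomologyMap (tateProjMor W F p (k + 1)) 1).hom y)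
  rw [cohomologyMap_torsionMulMor_tateProjMor, cohomologyMap_torsionMulMor_tateProjMor] at h
  rw [tateLevelValue, tateLevelValue, h]

include hcompat in
/-- The level values as integers `(⟨·,·⟩_{p^k}).val` form a `p`-adically coherent sequence. [cite: Serre1973, Ch. II §1] -/
theorem val_tateLevelValue_succ_modEq (k : ℕ) (x y : continuousCohomology 1 (restrictedTateRep W F p).toTopRep) :
    ((tateLevelValue W F p e hμ hadd₁ hadd₂ hgal (k + 1) x y).val : ℤ) ≡
      ((tateLevelValue W F p e hμ hadd₁ hadd₂ hgal k x y).val : ℤ) [ZMOD (p : ℤ) ^ k] := by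
  have h := castHom_tateLevelValue_succ W F p e hμ hadd₁ hadd₂ hgal hcompat k x y
  rw [ZMod.castHom_apply, ZMod.cast_eq_val] at h
  have h' : (((tateLevelValue W F p e hμ hadd₁ hadd₂ hgal (k + 1) x y).val : ℤ) : ZMod (p ^ k)) =
      (((tateLevelValue W F p e hμ hadd₁ hadd₂ hgal k x y).val : ℤ) : ZMod (p ^ k)) := by
    rw [Int.cast_natCast, Int.cast_natCast, h, ZMod.natCast_zmod_val]
  have := (ZMod.intCast_eq_intCast_iff _ _ _).1 h'
  push_cast at this
  exact this

/-! ### The `ℤ_p`-valued pairing -/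

include hcompat in
/-- Existence and uniqueness of the `p`-adic integer with the prescribed residues `⟨pr_k x, pr_k y⟩_{p^k}`
(`ℤ_p = lim ℤ/p^k`: `exists_padicInt_toZModPow_eq_intCast`, `PadicInt.ext_of_toZModPow`). [cite: Serre1973, Ch. II §1] -/
theorem existsUnique_toZModPow_eq_tateLevelValue (x y : continuousCohomology 1 (restrictedTateRep W F p).toTopRep) :
    ∃! z : ℤ_[p], ∀ k, PadicInt.toZModPow k z = tateLevelValue W F p e hμ hadd₁ hadd₂ hgal k x y := by
  obtain ⟨c, hc⟩ := exists_padicInt_toZModPow_eq_intCast p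
    (fun k => ((tateLevelValue W F p e hμ hadd₁ hadd₂ hgal k x y).val : ℤ))
    (fun k => val_tateLevelValue_succ_modEq W F p e hμ hadd₁ hadd₂ hgal hcompat k x y)
  refine ⟨c, fun k => ?_, fun z hz => PadicInt.ext_of_toZModPow.mp fun k => ?_⟩
  · rw [hc k, Int.cast_natCast, ZMod.natCast_zmod_val]
  · rw [hz k, hc k, Int.cast_natCast, ZMod.natCast_zmod_val]

/-- The value `⟨x, y⟩ ∈ ℤ_p` (the `p`-adic integer with residues `⟨pr_k x, pr_k y⟩_{p^k}`), as a bare function.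
[cite: NeukirchSchmidtWingberg2008, (7.2.6)] -/
def tatePairingFun (x y : continuousCohomology 1 (restrictedTateRep W F p).toTopRep) : ℤ_[p] :=
  (existsUnique_toZModPow_eq_tateLevelValue W F p e hμ hadd₁ hadd₂ hgal hcompat x y).choose

/-- The residues of `tatePairingFun`. [cite: NeukirchSchmidtWingberg2008, (7.2.6)] -/
theorem toZModPow_tatePairingFun (k : ℕ) (x y : continuousCohomology 1 (restrictedTateRep W F p).toTopRep) :
    PadicInt.toZModPow k (tatePairingFun W F p e hμ hadd₁ hadd₂ hgal hcompat x y) =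
      tateLevelValue W F p e hμ hadd₁ hadd₂ hgal k x y :=
  (existsUnique_toZModPow_eq_tateLevelValue W F p e hμ hadd₁ hadd₂ hgal hcompat x y).choose_spec.1 k

/-- ★★ **The `ℤ_p`-valued local Tate pairing on `H¹(F, T_pW)`**, `⟨x, y⟩ = (⟨pr_k x, pr_k y⟩_{p^k, inv_{p^k}})_k ∈
lim ℤ/p^k = ℤ_p`, bi-additive (the limit of the level-`p^k` local Tate self-pairings of `E[p^k]|_{Γ_F}` for THE
invariant maps; Kato II §1.4 / NSW (7.2.6) `H¹(K, T) × H¹(K, T*(1)) → ℤ_p` with `T*(1) ≅ T` by the Weil pairings).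
[cite: NeukirchSchmidtWingberg2008, (7.2.6)] [cite: Kato1993LNM1553, Ch. II §1.4] -/
def tatePairing :
    continuousCohomology 1 (restrictedTateRep W F p).toTopRep →+
      continuousCohomology 1 (restrictedTateRep W F p).toTopRep →+ ℤ_[p] :=
  AddMonoidHom.mk' (fun x => AddMonoidHom.mk' (fun y => tatePairingFun W F p e hμ hadd₁ hadd₂ hgal hcompat x y)
      fun y y' => PadicInt.ext_of_toZModPow.mp fun k => by
        rw [map_add, toZModPow_tatePairingFun, toZModPow_tatePairingFun, toZModPow_tatePairingFun,
          tateLevelValue_add_right])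
    fun x x' => AddMonoidHom.ext fun y => PadicInt.ext_of_toZModPow.mp fun k => by
      rw [AddMonoidHom.mk'_apply, AddMonoidHom.add_apply, AddMonoidHom.mk'_apply, AddMonoidHom.mk'_apply, map_add,
        toZModPow_tatePairingFun, toZModPow_tatePairingFun, toZModPow_tatePairingFun, tateLevelValue_add_left]

/-- ★ **The residues of the `ℤ_p`-valued pairing are the level pairings**: `⟨x, y⟩ mod p^k = ⟨pr_k x, pr_k y⟩_{p^k, inv_{p^k}}`.
[cite: NeukirchSchmidtWingberg2008, (7.2.6)] -/
theorem toZModPow_tatePairing (k : ℕ) (x y : continuousCohomology 1 (restrictedTateRep W F p).toTopRep) :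
    PadicInt.toZModPow k (tatePairing W F p e hμ hadd₁ hadd₂ hgal hcompat x y) =
      levelTatePairing W F (p ^ k) (e k) (hμ k) (hadd₁ k) (hadd₂ k) (hgal k) (Prop121vii.invLevel F (p ^ k))
        ((cohomologyMap (tateProjMor W F p k) 1).hom x) ((cohomologyMap (tateProjMor W F p k) 1).hom y) :=
  toZModPow_tatePairingFun W F p e hμ hadd₁ hadd₂ hgal hcompat k x y

/-- **The pairing is determined by its residues**: any `z ∈ ℤ_p` with `z mod p^k = ⟨pr_k x, pr_k y⟩_{p^k}` for all `k` is
`⟨x, y⟩` (`ℤ_p` is `p`-adically separated). [cite: Serre1973, Ch. II §1] -/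
theorem eq_tatePairing_of_toZModPow (x y : continuousCohomology 1 (restrictedTateRep W F p).toTopRep) (z : ℤ_[p])
    (hz : ∀ k, PadicInt.toZModPow k z = tateLevelValue W F p e hμ hadd₁ hadd₂ hgal k x y) :
    z = tatePairing W F p e hμ hadd₁ hadd₂ hgal hcompat x y :=
  PadicInt.ext_of_toZModPow.mp fun k => (hz k).trans (toZModPow_tatePairing W F p e hμ hadd₁ hadd₂ hgal hcompat k x y).symm

end Literature.NumberTheory.EllipticCurves

end
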